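import Literature.NumberTheory.PAdicHodge.AinfWeierstrassTorsionLift
import Literature.NumberTheory.PAdicHodge.BdRPlusTopology
import HarnessLib

/-!
# The ω-period `∫_t ω = log_Ŵ([t]) ∈ Fil¹ B_dR⁺(F)` of a Tate-module point of the formal group of an integral
# Weierstrass equation, and its `Γ_F`-equivariance

Topic `Literature/NumberTheory/PAdicHodge`; assembly of `AinfWeierstrassTorsionLift` (Fontaine's element
`[t] = lim [pⁿ]_W(ûₙ) ∈ ker θ ⊂ 𝔸_inf(F)` of a `[p]`-compatible sequence `t` of points of `Ŵ(𝔪_{ℂ_F})`) and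
`BdRPlusTopology` (evaluation of `ℚ`-power series on `Fil¹ B_dR⁺ = (ξ_dR)`, `ξ`-adically). For a Weierstrass equation
`W` over `ℤ`, a prime `p`, a `p`-adic field `F` and `t ∈ T_p Ŵ(𝒪_{ℂ_F})` (`[p] t_{n+1} = t_n`, `t₀ = 0`):

* `torsionLiftFil W t` — the image of `[t]` in `Fil¹ B_dR⁺` (`θ([t]) = 0`, `ker θ = ξ𝔸_inf ↦ (ξ_dR)`);
* **`omegaPeriod W t := log_W([t]) ∈ B_dR⁺(F)`** — the `p`-adic period of the invariant differential `ω` of `W`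
  along `t` (Fontaine 1982 §5; Colmez 1992 §2: `∫_t ω`; the elliptic analogue of `t = log[ε]`, tree `BdRPlusLog`),
  defined as the `ξ`-adically convergent evaluation of the formal logarithm `log_W ∈ ℚ⟦T⟧` (Silverman AEC IV.5.5)
  at `[t] ∈ Fil¹`; it lies in `Fil¹ B_dR⁺` (`omegaPeriod_mem_filOne`);
* **`gal_omegaPeriod : σ(∫_t ω) = ∫_{σ t} ω`** for every `σ ∈ Γ_F` — so `t ↦ ∫_t ω` is a `Γ_F`-equivariant map
  `T_p Ŵ(𝒪_{ℂ_F}) → Fil¹ B_dR⁺(F)`.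

Additivity in `t` (`∫_{t ⊕ t'} ω = ∫_t ω + ∫_{t'} ω`, from `log_W(X ⊕ Y) = log_W X + log_W Y`, tree
`formalLog_subst_formalGroupLaw`, and `[t ⊕ t'] = [t] ⊕ [t']`) and the non-vanishing modulo `Fil²` (Tate's Hodge–Tate
map) are the next steps of the programme (`Cruxes/StarredOptimalManinUnitFiveSeven/Lines/kato-lever-hDR-sector-iii-periods.md`)
and are NOT proved here. Definitions (reviewed): `logSeries`, `torsionLiftFil`, `omegaPeriod`. No named facts, no
`sorry`. BSD / K★: infrastructure for the supersingular sector of hDR; nothing about elliptic curves over number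
fields is proved here.

## References
* J.-M. Fontaine, *Formes différentielles et modules de Tate des variétés abéliennes sur les corps locaux*,
  Invent. Math. 65 (1982), §5 (the period pairing of a formal group). [Fontaine1982FormesDifferentielles]
* J.-M. Fontaine, *Le corps des périodes p-adiques*, Astérisque 223 (1994), Exp. II §1.5.4 (`t = log[ε]`). [FontaineAsterisque223III]
* J. H. Silverman, *The Arithmetic of Elliptic Curves* (2009), IV.5.5 (`log_𝓕`). [SilvermanAEC2009]
-/

noncomputable section

open Ideal Field WittVector MvPowerSeries

namespace Literature.NumberTheory.PAdicHodge

open Literature.NumberTheory.GaloisRepresentations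
open Literature.NumberTheory.GaloisRepresentations.IsNonarchimedeanLocalField
open Literature.NumberTheory.GaloisRepresentations.LubinTate

namespace AinfTop

variable {F : Type} [Field F] [ValuativeRel F] [TopologicalSpace F] [IsNonarchimedeanLocalField F] [CharZero F]
  {p : ℕ} [Fact p.Prime] [Fact (¬ IsUnit (p : integerC F))]
  [IsAdicComplete (Ideal.span {(p : integerC F)}) (integerC F)]
  {hθ : Function.Surjective (fontaineTheta (integerC F) p)}
  (W : WeierstrassCurve ℤ)

/-- **The formal logarithm `log_W ∈ ℚ⟦T⟧`** of `W` (Silverman AEC IV.5.5), as a series over the discrete coefficient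
ring `RatCoeff`. [cite: SilvermanAEC2009, IV.5.5] -/
def logSeries (W : WeierstrassCurve ℤ) : PowerSeries RatCoeff :=
  PowerSeries.map RatCoeff.of.toRingHom (W.map (Int.castRingHom ℚ)).formalLog

omit [CharZero F] [Fact p.Prime] [Fact (¬ IsUnit (p : integerC F))]
  [IsAdicComplete (Ideal.span {(p : integerC F)}) (integerC F)] in
/-- `log_W(0) = 0`. [cite: SilvermanAEC2009, IV.5.5] -/
theorem constantCoeff_logSeries : PowerSeries.constantCoeff (logSeries W) = 0 := by
  rw [logSeries, ← PowerSeries.coeff_zero_eq_constantCoeff_apply, PowerSeries.coeff_map,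
    PowerSeries.coeff_zero_eq_constantCoeff_apply, WeierstrassCurve.constantCoeff_formalLog, map_zero]

/-- `[t] ∈ ker θ = ξ𝔸_inf`. [cite: FontaineAsterisque223III, Exp. II §1.2.2] -/
theorem torsionLift_mem_span_xi {t : ℕ → (maxNilIdealC F).toIdeal} (ht0 : (t 0 : CBall F) = 0)
    (htp : ∀ n, mulPC F p W (t (n + 1)) = t n) :
    (of F p).symm (torsionLift W hθ t htp) ∈ Ideal.span {(xi : Ainf (p := p) F)} := by
  rw [← ker_fontaineTheta_eq_span_xi, RingHom.mem_ker]
  have h := theta_torsionLift W (hθ := hθ) ht0 htp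
  have h' := congrArg (fun z : CBall F => (z : CompletedAlgClosure F)) h
  simp only [ZeroMemClass.coe_zero] at h'
  exact Subtype.ext h'

/-- **`[t]` as an element of `Fil¹ B_dR⁺ = (ξ_dR)`.** [cite: FontaineAsterisque223III, Exp. II §1.5.2] -/
def torsionLiftFil (hθ : Function.Surjective (fontaineTheta (integerC F) p)) (t : ℕ → (maxNilIdealC F).toIdeal)
    (ht0 : (t 0 : CBall F) = 0) (htp : ∀ n, mulPC F p W (t (n + 1)) = t n) : (BdRPlusTop.filOne F p).toIdeal :=
  ⟨BdRPlusTop.ofAinf F p ((of F p).symm (torsionLift W hθ t htp)),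
    BdRPlusTop.ofAinf_mem_filOne (torsionLift_mem_span_xi W ht0 htp)⟩

/-- Unfolding `torsionLiftFil`. [cite: FontaineAsterisque223III, Exp. II §1.5.2] -/
theorem coe_torsionLiftFil {t : ℕ → (maxNilIdealC F).toIdeal} (ht0 : (t 0 : CBall F) = 0)
    (htp : ∀ n, mulPC F p W (t (n + 1)) = t n) :
    (torsionLiftFil W hθ t ht0 htp : BdRPlusTop F p) = BdRPlusTop.ofAinf F p ((of F p).symm (torsionLift W hθ t htp)) := rfl

/-- **The ω-period `∫_t ω := log_W([t]) ∈ B_dR⁺(F)`** of the Tate-module point `t` of `Ŵ(𝒪_{ℂ_F})`: the formal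
logarithm evaluated, `ξ`-adically, at Fontaine's element `[t] ∈ Fil¹`.
[cite: Fontaine1982FormesDifferentielles, §5] [cite: SilvermanAEC2009, IV.5.5] -/
def omegaPeriod (hθ : Function.Surjective (fontaineTheta (integerC F) p)) (t : ℕ → (maxNilIdealC F).toIdeal)
    (ht0 : (t 0 : CBall F) = 0) (htp : ∀ n, mulPC F p W (t (n + 1)) = t n) : BdRPlusTop F p :=
  (evalPt₁ (BdRPlusTop.filOne F p) (logSeries W) (constantCoeff_logSeries W) (torsionLiftFil W hθ t ht0 htp) :
    BdRPlusTop F p)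

/-- **`∫_t ω ∈ Fil¹ B_dR⁺`** (`log_W` has no constant term and `[t] ∈ Fil¹`). [cite: Fontaine1982FormesDifferentielles, §5] -/
theorem omegaPeriod_mem_filOne {t : ℕ → (maxNilIdealC F).toIdeal} (ht0 : (t 0 : CBall F) = 0)
    (htp : ∀ n, mulPC F p W (t (n + 1)) = t n) :
    omegaPeriod W hθ t ht0 htp ∈ (BdRPlusTop.filOne F p).toIdeal :=
  (evalPt₁ (BdRPlusTop.filOne F p) (logSeries W) (constantCoeff_logSeries W) (torsionLiftFil W hθ t ht0 htp)).2

omit [Fact p.Prime] [Fact (¬ IsUnit (p : integerC F))] [IsAdicComplete (Ideal.span {(p : integerC F)}) (integerC F)]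
  [CharZero F] in
/-- `σ t₀ = 0` when `t₀ = 0`. [cite: FontaineAsterisque223III, Exp. II §1.2] -/
theorem coe_galSeq_zero (σ : absoluteGaloisGroup F) {t : ℕ → (maxNilIdealC F).toIdeal} (ht0 : (t 0 : CBall F) = 0) :
    (galSeq F σ t 0 : CBall F) = 0 := by
  rw [coe_galSeq, ht0, map_zero]

/-- `σ([t]) = [σ t]` in `Fil¹ B_dR⁺`. [cite: FontaineAsterisque223III, Exp. II §1.5] -/
theorem gal_torsionLiftFil (σ : absoluteGaloisGroup F) {t : ℕ → (maxNilIdealC F).toIdeal} (ht0 : (t 0 : CBall F) = 0)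
    (htp : ∀ n, mulPC F p W (t (n + 1)) = t n) :
    BdRPlusTop.gal F p σ (torsionLiftFil W hθ t ht0 htp : BdRPlusTop F p) =
      (torsionLiftFil W hθ (galSeq F σ t) (coe_galSeq_zero σ ht0) (mulPC_galSeq W hθ σ htp) : BdRPlusTop F p) := by
  rw [coe_torsionLiftFil, coe_torsionLiftFil, BdRPlusTop.gal_ofAinf, ← gal_torsionLift W σ htp]
  rfl

/-- **`Γ_F`-equivariance of the ω-period: `σ(∫_t ω) = ∫_{σ t} ω`.** [cite: Fontaine1982FormesDifferentielles, §5]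
[cite: FontaineAsterisque223III, Exp. II §1.5.4] -/
theorem gal_omegaPeriod (σ : absoluteGaloisGroup F) {t : ℕ → (maxNilIdealC F).toIdeal} (ht0 : (t 0 : CBall F) = 0)
    (htp : ∀ n, mulPC F p W (t (n + 1)) = t n) :
    BdRPlusTop.gal F p σ (omegaPeriod W hθ t ht0 htp) =
      omegaPeriod W hθ (galSeq F σ t) (coe_galSeq_zero σ ht0) (mulPC_galSeq W hθ σ htp) := by
  rw [omegaPeriod, omegaPeriod, BdRPlusTop.gal_evalPt₁]
  congr 2
  exact Subtype.ext (gal_torsionLiftFil W σ ht0 htp)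

end AinfTop

end Literature.NumberTheory.PAdicHodge

end
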